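import Literature.InformationTheory.QuantumCodes.PlanarCodeCrossingPathsBound
import Mathlib.Combinatorics.SimpleGraph.Paths
import HarnessLib

/-!
# Check matrices DRAWN on `ℤ^d` (incidence = geometry): the hand-shaking lemma, rough-to-rough self-avoiding crossing
# paths and their extraction from an odd-crossing cycle — once, for every graphlike check matrix with two rough edges

Topic `Literature/InformationTheory/QuantumCodes` (venture QEC, LADDER-QEC rung Q5, PARTITION row 09; qec-type-09 gen 7, cell
item «09.RSCPH»). All PROVED, kernel axioms, no named fact. The tree proves DKLP's relative-polygon bound four times by
the same argument (`PlanarCodeCrossingPaths*`, `PlanarCodeSpaceTime*`, `RotatedSurfaceCodeLift`/`CrossingPaths*`,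
`RotatedSurfaceCodeLiftZ`/`CrossingPathsZ*`). This file isolates the argument. A **drawing** of a binary matrix
`M : X × Λ → 𝔽₂` (checks `X`, error locations `Λ`) on `ℤ^d` (`CheckDrawing M d B Tt`) assigns to every check an
injective SITE, to every location an injective BOND between adjacent sites, so that INCIDENCE IS GEOMETRY
(`M x ℓ = [site x ∈ bond ℓ]`), together with two families of VIRTUAL sites `vb : B → ℤ^d` (bottom rough edge) and
`vt : Tt → ℤ^d` (top rough edge) carrying no check, such that every bond end is a check site or virtual, and a
bottom-crossing indicator `bot ℓ = #{ends of bond ℓ on the bottom edge} (mod 2)`.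

* ★ `exists_reachable_of_odd` — **hand-shaking**: a cycle `M C = 0` supported in `Er` with `Σ_ℓ C(ℓ)·bot(ℓ) = 1` joins
  some `vb b` to some `vt t` through bonds of `Er` (sum the vanishing syndrome over the checks reachable from the bottom
  edge: a bond between two checks contributes `0` or `2`, a bottom dangling bond `1`, a top dangling bond `0`);
* `pathEdge`, `IsCrossing`, `pathLocs`, `card_pathLocs`, `mulVec_pathLocs` — rough-to-rough self-avoiding paths
  (`ω ∈ SAW.Zd.saws d n` from `vb b₀`, ending at some `vt t`), their `n` locations, their syndrome-freeness;
* ★ `exists_crossing_subset` — extraction of such a path inside `Er` (Mathlib's `Walk.bypass`);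
The height gap / length bound, the half-weight step (eq. (e_ineq)) and the counting bound `≤ |B|·C·r^{n₀}/(1-r)` are
`DrawnCheckMatrixCountingBound.lean`; instances (the space-time lift of a drawing, the rotated surface code under noisy
measurement) are separate files.

## References

* [DennisEtAl2002] E. Dennis, A. Kitaev, A. Landahl, J. Preskill, *Topological quantum memory*, J. Math. Phys. 43 (2002)
  4452–4505, arXiv:quant-ph/0110143, §3.2 (rough edges, relative cycles), §4.3 (syndrome = boundary), §5.2 (eqs. (e_ineq),
  (27)–(28): self-avoiding walks, `H ≥ L`, `H_e ≥ H/2`), §5.3 (eqs. (29), (saw_d), (fail); "To bound the failure probability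
  for a planar code rather than the toric code, we should count the 'relative polygons' that stretch from one edge of the
  lattice to the opposite edge").
* [MadrasSlade1993] N. Madras, G. Slade, *The Self-Avoiding Walk*, Birkhäuser 1993, §1.1 (`cₙ`).
-/

namespace Literature.InformationTheory.QuantumCodes

open Finset Matrix
open Literature.Probability.LatticeModels (Site zdGraph)
open Literature.Probability.Percolation (BondConfig openGraph openGraph_adj)
open Literature.Probability.RandomPlanarGeometry
open Literature.Probability.RandomPlanarGeometry.SAW.Zd (saws mem_saws card_saws zdGraph_adj_iff_sub zdGraph_adj_sub_right)

open Classical in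
/-- **A check matrix drawn on `ℤ^d` with two rough edges**: checks at injective sites, locations as injective bonds between
adjacent sites, incidence = geometry, bottom / top virtual sites carrying no check, every bond end a check site or
virtual, and the bottom-crossing indicator `bot`. (The planar code: `X`-checks at `(a, b)`, rough edges `a = -1`,
`a = k+1`; the rotated surface code on the diagonal lattice; their space-time lifts.)
[cite: DennisEtAl2002, §3.2 (rough edges: links with one end off the lattice) and §4.3 (syndrome = boundary)] -/
structure CheckDrawing {X Λ : Type*} (M : Matrix X Λ (ZMod 2)) (d : ℕ) (B Tt : Type*) where
  /-- the site of a check -/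
  site : X → Site d
  /-- the bond of an error location -/
  bond : Λ → Sym2 (Site d)
  /-- the bottom virtual sites -/
  vb : B → Site d
  /-- the top virtual sites -/
  vt : Tt → Site d
  /-- the bottom-crossing indicator of a location -/
  bot : Λ → ZMod 2
  site_injective : Function.Injective site
  bond_injective : Function.Injective bond
  adj_of_bond_eq : ∀ ℓ (P P' : Site d), bond ℓ = s(P, P') → (zdGraph d).Adj P P'
  apply_eq_ite : ∀ x ℓ, M x ℓ = if site x ∈ bond ℓ then 1 else 0
  site_ne_vb : ∀ x b, site x ≠ vb b
  site_ne_vt : ∀ x t, site x ≠ vt t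
  vb_ne_vt : ∀ b t, vb b ≠ vt t
  ends_cases : ∀ ℓ, ∀ P ∈ bond ℓ, (∃ x, site x = P) ∨ (∃ b, vb b = P) ∨ (∃ t, vt t = P)
  bot_eq : ∀ ℓ (P P' : Site d), bond ℓ = s(P, P') →
    bot ℓ = (if ∃ b, vb b = P then 1 else 0) + (if ∃ b, vb b = P' then 1 else 0)

namespace CheckDrawing

variable {X Λ B Tt : Type*} {d : ℕ} {M : Matrix X Λ (ZMod 2)} (Δ : CheckDrawing M d B Tt)

/-! ### The lift and the hand-shaking lemma -/

/-- **The lift** of a set of locations: the bond configuration of `ℤ^d` whose open bonds are their bonds.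
[cite: DennisEtAl2002, §3.2 (error chains as links of the lattice)] -/
def lift (Er : Finset Λ) : BondConfig (Site d) := {e | ∃ ℓ ∈ Er, Δ.bond ℓ = e}

/-- A location of `Er` opens its bond. [cite: DennisEtAl2002, §3.2] -/
theorem lift_adj_of_mem {Er : Finset Λ} {ℓ : Λ} (hℓ : ℓ ∈ Er) {P P' : Site d} (h : Δ.bond ℓ = s(P, P')) :
    (openGraph (Δ.lift Er)).Adj P P' := by
  rw [openGraph_adj]
  exact ⟨⟨ℓ, hℓ, h⟩, (Δ.adj_of_bond_eq ℓ P P' h).ne⟩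

/-- Every bond is a genuine pair `s(P, P')` of sites (a link has two ends). [cite: DennisEtAl2002, §3.2 (links of the lattice)] -/
theorem exists_bond_eq (ℓ : Λ) : ∃ P P' : Site d, Δ.bond ℓ = s(P, P') :=
  Sym2.ind (fun P P' => ⟨P, P', rfl⟩) (Δ.bond ℓ)

/-- In `ℤ₂`, the indicator of membership in a genuine pair is the sum of the two point indicators. [folklore] -/
private theorem ite_mem_sym2_eq_add {P A A' : Site d} (hAA' : A ≠ A') :
    (if P ∈ s(A, A') then (1 : ZMod 2) else 0) = (if P = A then 1 else 0) + (if P = A' then 1 else 0) := by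
  classical
  simp only [Sym2.mem_iff]
  by_cases hA : P = A
  · rw [if_pos (Or.inl hA), if_pos hA, if_neg (fun h => hAA' (hA.symm.trans h)), add_zero]
  · by_cases hB : P = A'
    · rw [if_pos (Or.inr hB), if_neg hA, if_pos hB, zero_add]
    · rw [if_neg (not_or.2 ⟨hA, hB⟩), if_neg hA, if_neg hB, add_zero]

/-- **The syndrome at a check is the parity of the chain on the bonds at its site.**
[cite: DennisEtAl2002, §4.3 (syndrome = boundary of the error chain)] -/
theorem mulVec_apply_eq_sum [Fintype Λ] (c : Λ → ZMod 2) (x : X) :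
    (M *ᵥ c) x = ∑ ℓ, if Δ.site x ∈ Δ.bond ℓ then c ℓ else 0 := by
  classical
  simp only [mulVec, dotProduct, Δ.apply_eq_ite]
  exact Finset.sum_congr rfl fun ℓ _ => by split_ifs <;> simp

/-- ★ **Hand-shaking: an odd bottom crossing reaches the top edge.** If `C` is a cycle (`M C = 0`) supported in `Er` with
`Σ_ℓ C(ℓ)·bot(ℓ) = 1`, some bottom virtual site is joined through bonds of `Er` to some top virtual site. (Sum the vanishing
syndrome over the checks reachable from the bottom edge.) [cite: DennisEtAl2002, §3.2 and §5.3 (relative polygons stretching from one edge to the opposite edge)] -/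
theorem exists_reachable_of_odd [Fintype X] [Fintype Λ] {Er : Finset Λ} {C : Λ → ZMod 2} (hC : M *ᵥ C = 0)
    (hCE : ∀ ℓ, C ℓ ≠ 0 → ℓ ∈ Er) (hodd : ∑ ℓ, C ℓ * Δ.bot ℓ = 1) :
    ∃ (b : B) (t : Tt), (openGraph (Δ.lift Er)).Reachable (Δ.vb b) (Δ.vt t) := by
  classical
  by_contra hno
  push Not at hno
  set G := openGraph (Δ.lift Er) with hG
  set R : Site d → Prop := fun P => ∃ b : B, G.Reachable (Δ.vb b) P with hR
  have hRadj : ∀ {P P' : Site d}, G.Adj P P' → (R P ↔ R P') := fun h =>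
    ⟨fun ⟨b, hr⟩ => ⟨b, hr.trans h.reachable⟩, fun ⟨b, hr⟩ => ⟨b, hr.trans h.symm.reachable⟩⟩
  have hRvb : ∀ b, R (Δ.vb b) := fun b => ⟨b, SimpleGraph.Reachable.refl _⟩
  have hRvt : ∀ t, ¬ R (Δ.vt t) := fun t ⟨b, h⟩ => hno b t h
  set χ : X → ZMod 2 := fun x => if R (Δ.site x) then 1 else 0 with hχ
  have hχ_eval : ∀ x, χ x = if R (Δ.site x) then 1 else 0 := fun x => rfl
  set f : Site d → ZMod 2 := fun P => ∑ x, χ x * (if Δ.site x = P then 1 else 0) with hf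
  have hf_site : ∀ x₀, f (Δ.site x₀) = χ x₀ := by
    intro x₀
    simp only [hf]
    rw [Finset.sum_eq_single x₀]
    · simp
    · intro x _ hx
      rw [if_neg (fun h => hx (Δ.site_injective h)), mul_zero]
    · intro h; exact absurd (Finset.mem_univ _) h
  have hf_virtual : ∀ P : Site d, (∀ x, Δ.site x ≠ P) → f P = 0 := fun P hP => by
    simp only [hf]
    exact Finset.sum_eq_zero fun x _ => by rw [if_neg (hP x), mul_zero]
  have hf_vb : ∀ b, f (Δ.vb b) = 0 := fun b => hf_virtual _ fun x => Δ.site_ne_vb x b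
  have hf_vt : ∀ t, f (Δ.vt t) = 0 := fun t => hf_virtual _ fun x => Δ.site_ne_vt x t
  have hvb_self : ∀ b, ∃ b', Δ.vb b' = Δ.vb b := fun b => ⟨b, rfl⟩
  have hsite_not : ∀ x, ¬ ∃ b, Δ.vb b = Δ.site x := fun x ⟨b, hb⟩ => Δ.site_ne_vb x b hb.symm
  have hvt_not : ∀ t, ¬ ∃ b, Δ.vb b = Δ.vt t := fun t ⟨b, hb⟩ => Δ.vb_ne_vt b t hb
  -- `g ℓ = Σ_x χ(x) M(x, ℓ) = f(P₁) + f(P₂)` for the bond `{P₁, P₂}` of `ℓ`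
  have hg : ∀ (ℓ : Λ) {P₁ P₂ : Site d}, Δ.bond ℓ = s(P₁, P₂) → ∑ x, χ x * M x ℓ = f P₁ + f P₂ := by
    intro ℓ P₁ P₂ hℓ
    have hne : P₁ ≠ P₂ := (Δ.adj_of_bond_eq ℓ P₁ P₂ hℓ).ne
    simp only [hf, ← Finset.sum_add_distrib, ← mul_add]
    refine Finset.sum_congr rfl fun x _ => ?_
    rw [Δ.apply_eq_ite, hℓ, ite_mem_sym2_eq_add hne]
  -- evaluation of `g` on the open bonds
  have hval : ∀ ℓ ∈ Er, ∑ x, χ x * M x ℓ = Δ.bot ℓ := by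
    intro ℓ hℓ
    obtain ⟨P₁, P₂, hℓe⟩ := Δ.exists_bond_eq ℓ
    rw [hg ℓ hℓe, Δ.bot_eq ℓ P₁ P₂ hℓe]
    have hiff := hRadj (Δ.lift_adj_of_mem hℓ hℓe)
    have hm₁ : P₁ ∈ Δ.bond ℓ := by rw [hℓe]; exact Sym2.mem_mk_left _ _
    have hm₂ : P₂ ∈ Δ.bond ℓ := by rw [hℓe]; exact Sym2.mem_mk_right _ _
    rcases Δ.ends_cases ℓ P₁ hm₁ with ⟨x₁, rfl⟩ | ⟨b₁, rfl⟩ | ⟨t₁, rfl⟩ <;>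
      rcases Δ.ends_cases ℓ P₂ hm₂ with ⟨x₂, rfl⟩ | ⟨b₂, rfl⟩ | ⟨t₂, rfl⟩
    · rw [hf_site, hf_site, hχ_eval, hχ_eval, if_neg (hsite_not x₁), if_neg (hsite_not x₂)]
      by_cases hr : R (Δ.site x₁)
      · rw [if_pos hr, if_pos (hiff.1 hr)]; decide
      · rw [if_neg hr, if_neg (fun h => hr (hiff.2 h))]
    · rw [hf_site, hf_vb, hχ_eval, if_neg (hsite_not x₁), if_pos (hvb_self b₂), if_pos (hiff.2 (hRvb b₂))]; decide
    · rw [hf_site, hf_vt, hχ_eval, if_neg (hsite_not x₁), if_neg (hvt_not t₂), if_neg (fun h => hRvt t₂ (hiff.1 h))]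
    · rw [hf_vb, hf_site, hχ_eval, if_pos (hvb_self b₁), if_neg (hsite_not x₂), if_pos (hiff.1 (hRvb b₁))]; decide
    · rw [hf_vb, hf_vb, if_pos (hvb_self b₁), if_pos (hvb_self b₂)]; decide
    · exact absurd (hiff.1 (hRvb b₁)) (hRvt t₂)
    · rw [hf_vt, hf_site, hχ_eval, if_neg (hvt_not t₁), if_neg (hsite_not x₂), if_neg (fun h => hRvt t₁ (hiff.2 h))]
    · exact absurd (hiff.2 (hRvb b₂)) (hRvt t₁)
    · rw [hf_vt, hf_vt, if_neg (hvt_not t₁), if_neg (hvt_not t₂)]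
  -- (1) the total syndrome over the reachable checks vanishes; (2) swap the sums
  have h1 : ∑ x, χ x * (M *ᵥ C) x = 0 := Finset.sum_eq_zero fun x _ => by rw [hC, Pi.zero_apply, mul_zero]
  have h2 : ∑ x, χ x * (M *ᵥ C) x = ∑ ℓ, C ℓ * ∑ x, χ x * M x ℓ := by
    simp only [mulVec, dotProduct, Finset.mul_sum]
    rw [Finset.sum_comm]
    exact Finset.sum_congr rfl fun ℓ _ => Finset.sum_congr rfl fun x _ => by ring
  -- (3) only the bottom crossings survive
  have h3 : ∑ ℓ, C ℓ * ∑ x, χ x * M x ℓ = ∑ ℓ, C ℓ * Δ.bot ℓ := by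
    refine Finset.sum_congr rfl fun ℓ _ => ?_
    by_cases hC0 : C ℓ = 0
    · rw [hC0, zero_mul, zero_mul]
    · rw [hval ℓ (hCE ℓ hC0)]
  rw [h2, h3, hodd] at h1
  exact one_ne_zero h1

/-! ### Rough-to-rough self-avoiding paths -/

/-- The `i`-th bond `{vb b₀ + ω(i), vb b₀ + ω(i+1)}` of the path from the bottom virtual site `vb b₀` following `ω`.
[cite: DennisEtAl2002, §5.3 (relative polygons with endpoints on the boundary)] -/
def pathEdge (b₀ : B) (ω : ℕ → Site d) (i : ℕ) : Sym2 (Site d) := s(Δ.vb b₀ + ω i, Δ.vb b₀ + ω (i + 1))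

/-- **A rough-to-rough path** (`n` steps from `vb b₀` along `ω`): its bonds are bonds of locations and it ends at a top
virtual site. [cite: DennisEtAl2002, §5.3 (relative polygon, endpoints on the boundary)] -/
def IsCrossing (b₀ : B) (n : ℕ) (ω : ℕ → Site d) : Prop :=
  (∀ i < n, ∃ ℓ, Δ.bond ℓ = Δ.pathEdge b₀ ω i) ∧ ∃ t, Δ.vb b₀ + ω n = Δ.vt t

open Classical in
/-- The locations whose bonds are the first `n` bonds of the path. [cite: DennisEtAl2002, §5.2 (the links of the path)] -/
noncomputable def pathLocs [Fintype Λ] (b₀ : B) (n : ℕ) (ω : ℕ → Site d) : Finset Λ :=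
  univ.filter fun ℓ => ∃ i < n, Δ.bond ℓ = Δ.pathEdge b₀ ω i

/-- The bonds of a self-avoiding path are pairwise distinct. [cite: MadrasSlade1993, §1.1] -/
theorem pathEdge_injOn {n : ℕ} {ω : ℕ → Site d} (hω : ω ∈ saws d n) (b₀ : B) :
    Set.InjOn (Δ.pathEdge b₀ ω) (Finset.range n : Set ℕ) := by
  obtain ⟨-, -, -, hinj⟩ := mem_saws.1 hω
  intro i hi j hj h
  simp only [Finset.coe_range, Set.mem_Iio] at hi hj
  simp only [pathEdge, Sym2.eq_iff, add_right_inj] at h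
  rcases h with ⟨h1, -⟩ | ⟨h1, h2⟩
  · exact hinj (show i ≤ n by omega) (show j ≤ n by omega) h1
  · have hi' := hinj (show i ≤ n by omega) (show j + 1 ≤ n by omega) h1
    have hj' := hinj (show i + 1 ≤ n by omega) (show j ≤ n by omega) h2
    omega

open Classical in
/-- The bond map carries `pathLocs` onto the bonds of the path. [cite: DennisEtAl2002, §5.2 (the links of the path)] -/
theorem image_bond_pathLocs [Fintype Λ] {b₀ : B} {n : ℕ} {ω : ℕ → Site d} (hX : Δ.IsCrossing b₀ n ω) :
    (Δ.pathLocs b₀ n ω).image Δ.bond = (Finset.range n).image (Δ.pathEdge b₀ ω) := by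
  ext e
  simp only [Finset.mem_image, pathLocs, Finset.mem_filter, Finset.mem_univ, true_and, Finset.mem_range]
  constructor
  · rintro ⟨ℓ, ⟨i, hi, hℓ⟩, rfl⟩
    exact ⟨i, hi, hℓ.symm⟩
  · rintro ⟨i, hi, rfl⟩
    obtain ⟨ℓ, hℓ⟩ := hX.1 i hi
    exact ⟨ℓ, ⟨i, hi, hℓ⟩, hℓ⟩

open Classical in
/-- **A crossing self-avoiding path with `n` steps uses exactly `n` locations.** [cite: DennisEtAl2002, §5.2 (H links)] -/
theorem card_pathLocs [Fintype Λ] {b₀ : B} {n : ℕ} {ω : ℕ → Site d} (hω : ω ∈ saws d n)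
    (hX : Δ.IsCrossing b₀ n ω) : (Δ.pathLocs b₀ n ω).card = n := by
  rw [← Finset.card_image_of_injective (Δ.pathLocs b₀ n ω) Δ.bond_injective, Δ.image_bond_pathLocs hX,
    Finset.card_image_of_injOn (Δ.pathEdge_injOn hω b₀), Finset.card_range]

open Classical in
/-- Sums over the locations of the path are sums over its bonds. [cite: DennisEtAl2002, §5.2 (the links of the path)] -/
theorem sum_pathLocs_eq [Fintype Λ] {A : Type*} [AddCommMonoid A] {b₀ : B} {n : ℕ} {ω : ℕ → Site d}
    (hω : ω ∈ saws d n) (hX : Δ.IsCrossing b₀ n ω) (g : Sym2 (Site d) → A) :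
    ∑ ℓ ∈ Δ.pathLocs b₀ n ω, g (Δ.bond ℓ) = ∑ i ∈ Finset.range n, g (Δ.pathEdge b₀ ω i) := by
  rw [← Finset.sum_image (fun ℓ _ ℓ' _ h => Δ.bond_injective h), Δ.image_bond_pathLocs hX,
    Finset.sum_image (Δ.pathEdge_injOn hω b₀)]

/-- Telescoping modulo `2`: `Σ_{i<n} (f(i) + f(i+1)) = f(0) + f(n)` in `ℤ₂`. [folklore] -/
private theorem sum_range_add_succ_eq (f : ℕ → ZMod 2) (n : ℕ) :
    ∑ i ∈ Finset.range n, (f i + f (i + 1)) = f 0 + f n := by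
  have h2 : ∀ x : ZMod 2, x + x = 0 := by decide
  induction n with
  | zero => rw [Finset.sum_range_zero, h2]
  | succ n ih =>
    rw [Finset.sum_range_succ, ih]
    calc f 0 + f n + (f n + f (n + 1)) = f 0 + f (n + 1) + (f n + f n) := by ring
      _ = f 0 + f (n + 1) := by rw [h2, add_zero]

/-- **A rough-to-rough path carries no syndrome**: `M 𝟙_P = 0` for the location set `P` of a crossing self-avoiding path —
every check is met by `0` or `2` of its bonds, both ends being virtual. [cite: DennisEtAl2002, §3.2 and §4.3 (a relative cycle ending on the rough edges has no boundary)] -/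
theorem mulVec_pathLocs [Fintype Λ] [DecidableEq Λ] {b₀ : B} {n : ℕ} {ω : ℕ → Site d} (hω : ω ∈ saws d n)
    (hX : Δ.IsCrossing b₀ n ω) {χ : Λ → ZMod 2} (hχ : ∀ ℓ, χ ℓ = if ℓ ∈ Δ.pathLocs b₀ n ω then 1 else 0) :
    M *ᵥ χ = 0 := by
  classical
  obtain ⟨h0, -, hadj, -⟩ := mem_saws.1 hω
  obtain ⟨t, ht⟩ := hX.2
  funext x
  rw [Pi.zero_apply, Δ.mulVec_apply_eq_sum]
  set v : Site d := Δ.site x with hv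
  set f : ℕ → ZMod 2 := fun i => if v = Δ.vb b₀ + ω i then 1 else 0 with hf
  have h1 : (∑ ℓ, if v ∈ Δ.bond ℓ then χ ℓ else 0) =
      ∑ ℓ ∈ Δ.pathLocs b₀ n ω, if v ∈ Δ.bond ℓ then (1 : ZMod 2) else 0 := by
    rw [← Fintype.sum_extend_by_zero (Δ.pathLocs b₀ n ω)]
    refine Finset.sum_congr rfl fun ℓ _ => ?_
    rw [hχ ℓ]
    split_ifs <;> rfl
  have h2 : ∀ i ∈ Finset.range n, (if v ∈ Δ.pathEdge b₀ ω i then (1 : ZMod 2) else 0) = f i + f (i + 1) := by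
    intro i hi
    rw [Finset.mem_range] at hi
    have hne : Δ.vb b₀ + ω i ≠ Δ.vb b₀ + ω (i + 1) := fun h => (hadj i hi).ne (add_left_cancel h)
    simp only [pathEdge, hf]
    exact ite_mem_sym2_eq_add hne
  have h3 : f 0 = 0 := by
    simp only [hf, h0, add_zero, hv]
    exact if_neg (Δ.site_ne_vb x b₀)
  have h4 : f n = 0 := by
    simp only [hf, ht, hv]
    exact if_neg (Δ.site_ne_vt x t)
  rw [h1, Δ.sum_pathLocs_eq hω hX (fun e => if v ∈ e then (1 : ZMod 2) else 0), Finset.sum_congr rfl h2,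
    sum_range_add_succ_eq, h3, h4, add_zero]

/-! ### Extraction -/

/-- ★ **A cycle with an odd bottom crossing contains a rough-to-rough self-avoiding path** whose locations lie in any
set `Er` supporting the cycle: the hand-shaking lemma joins a bottom virtual site to a top one through bonds of `Er`;
removing loops (Mathlib's `Walk.bypass`) leaves a self-avoiding walk, read from its start as an element of
`SAW.Zd.saws d n`. [cite: DennisEtAl2002, §5.2–5.3 (self-avoiding walks; relative polygons)] -/
theorem exists_crossing_subset [Fintype X] [Fintype Λ] {Er : Finset Λ} {C : Λ → ZMod 2} (hC : M *ᵥ C = 0)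
    (hCE : ∀ ℓ, C ℓ ≠ 0 → ℓ ∈ Er) (hodd : ∑ ℓ, C ℓ * Δ.bot ℓ = 1) :
    ∃ (b₀ : B) (n : ℕ) (ω : ℕ → Site d), ω ∈ saws d n ∧ Δ.IsCrossing b₀ n ω ∧ Δ.pathLocs b₀ n ω ⊆ Er := by
  classical
  obtain ⟨b₀, t, hreach⟩ := Δ.exists_reachable_of_odd hC hCE hodd
  obtain ⟨W⟩ := hreach
  set s : Site d := Δ.vb b₀ with hs
  set P : (openGraph (Δ.lift Er)).Walk s (Δ.vt t) := W.bypass with hP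
  have hpath : P.IsPath := W.bypass_isPath
  set n := P.length with hn
  set ω : ℕ → Site d := fun i => P.getVert i - s with hω
  have hωs : ∀ i, s + ω i = P.getVert i := fun i => by simp only [hω]; abel
  have hstep : ∀ i < n, ∃ ℓ ∈ Er, Δ.bond ℓ = Δ.pathEdge b₀ ω i := by
    intro i hi
    have hA := P.adj_getVert_succ hi
    rw [openGraph_adj] at hA
    obtain ⟨⟨ℓ, hℓ, hℓe⟩, -⟩ := hA
    refine ⟨ℓ, hℓ, ?_⟩
    rw [hℓe, pathEdge, ← hs, hωs, hωs]
  refine ⟨b₀, n, ω, ?_, ⟨fun i hi => ?_, t, ?_⟩, fun ℓ hℓ => ?_⟩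
  · refine mem_saws.2 ⟨by simp [hω], fun i hi => ?_, fun i hi => ?_, fun i hi j hj hij => ?_⟩
    · simp only [hω]
      rw [P.getVert_of_length_le hi, P.getVert_length]
    · obtain ⟨ℓ, -, hℓ⟩ := hstep i hi
      have hA := Δ.adj_of_bond_eq ℓ _ _ hℓ
      rwa [← zdGraph_adj_sub_right _ _ s, add_sub_cancel_left, add_sub_cancel_left] at hA
    · exact hpath.getVert_injOn hi hj (sub_left_injective hij)
  · obtain ⟨ℓ, -, hℓ⟩ := hstep i hi
    exact ⟨ℓ, hℓ⟩
  · rw [hωs, P.getVert_of_length_le le_rfl]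
  · rw [pathLocs, Finset.mem_filter] at hℓ
    obtain ⟨i, hi, hℓi⟩ := hℓ.2
    obtain ⟨ℓ', hℓ', hℓ'i⟩ := hstep i hi
    rwa [← Δ.bond_injective (hℓi.trans hℓ'i.symm)] at hℓ'

end CheckDrawing

end Literature.InformationTheory.QuantumCodes
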